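import Summits.QuantumFields.BalabanUV.Beta.D1BFx.GhostLegBlockMass
import Summits.QuantumFields.BalabanUV.Beta.D1BFx.GluonLegTails
import Summits.QuantumFields.BalabanUV.Beta.D1BFx.LocalTadpoleRows

/-!
# `BalabanUV.Beta.D1BFx.GluonLegBlockMass` — road «BF-x» for binder row D1, slot (K), END row `hGrp gN`, letter (L1)-MASS: THE BLOCK-ROW |·|-MASS OF THE
# GLUON LEG `Ga = K^∞` IS `O(n²)` WITH BLOCK DECAY — `Σ_{t ∈ B(n−1) β} |Ga n a y t κ l| ≤ C·n²·e^{−δ·dist(blk y, β)}`, one `C ≥ 0`, `δ > 0` for every `n ≥ 1`,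
# modulo [B5, Prop. 1.2] ∧ [B5, (1.126)–(1.127)] BY NAME (through leaf-03's `GluonLegTails.Kinf_entry_le_of_prop12`) — the gluon twin of M10
# (`GhostLegBlockMass.sum_B_abs_Ggh_le`, n-FREE for the scalar ghost leg `Ggh ∼ n⁻²r⁻²`; here `Ga ∼ r⁻²` has mass `n²` per block = an3-g57 §3′ (2) «fine masses
# `Σ_{x′}|Ga(x,x′)| ≤ k·n²` … ALL BY NAME modulo h12∕h126»)

HONEST DEPENDENCY (cell records, verbatim): «continuum YM on T⁴ ⇐ BetaPertH ∧ nine spine estimates (0/9 proved); BetaPertH ⇐ (D1) ∧ (D4) ∧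
CAP+tail; G-an2-4 gates asym, D1 and NE2/3/4.»  HONEST FRAMING (cell contract, verbatim): «discharging `BetaPertH` makes Bałaban's UV stability
UNCONDITIONAL — a real constructive-QFT result; it is NOT the continuum limit and NOT the Clay problem.»  THIS MODULE DISCHARGES NOTHING of the
wall: [folklore] lattice bookkeeping — §1 a GENERIC block-mass count for any two-point function with a Coulomb × scale-n-exponential profile off the
diagonal and a bounded diagonal (the proof of M10 verbatim with `n⁻²·r⁻²` replaced by `r⁻²`), §2 its instantiation at `Ga` with the profile supplied BY NAME
by `GluonLegTails.Kinf_entry_le_of_prop12` (conditional on the two PRINTED statements `h12`∕`h126`, exactly as the END displays them) and the diagonal by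
leaf-04-g8's hypothesis-free `LocalTadpoleRows.abs_Ga_le_flatEntry`.  No `def`, no `def … : Prop`, nothing cited, 0 sorry; the printed statements enter
as HYPOTHESES by name, never as facts.  Root-level binders hW ∕ hR-sockets ∕ hSX-socket ∕ D1Tel ∕ D1Rep — 0 discharged; (K) NOT closed; NOT D1, NOT
`BetaPertH`, NOT continuum, NOT Clay.

ABSOLUTE RULE (cell charter, verbatim): «No internally-minted statement may enter as a cited fact. Every hypothesis is either kernel-proved in
this package or a verbatim quotation of a PUBLISHED theorem with page reference. The manuscript(s) under audit are NOT citable for their own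
disputed steps — they are the thing under adjudication; programme-internal (2001/route/tribunal) claims are never citable.»

WHY (owner `GLUON-NEEDLE-ROWS.md` v0.1 ∕ RULING ρ-g9-33 (L1); an3-g57 `N36-SPLIT.v1.md` §3′ (2)–(4); owner «GN-𝔅» `RankOneBubbleJets.bubble_dJetSw_dJetSw`
p260851).  Every gluon needle word of T₁∕T₂∕T₃ is a product of pairings `⟨∇h, Ga ∇f⟩` and point values `(Ga ∇f)(u,κ)`; bounding a point value
`Σ_y Ga(x,y)·∇f(y)` against a block-structured `∇f` (a projector column, a needle potential) block by block needs the |·|-mass of a ROW of `Ga` over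
one block with its decay in the block distance — this file.  The R-column twin (`RG = Ggh − Pgt∘Ggh`) is leaf-05's `RColumnBlockMass`; the scalar twin is M10.

CONTENT.
* §1 [folklore] **`sum_B_abs_le_of_profile`** — for `G : Pt → Pt → ℝ` with `|G y t| ≤ A₀·e^{−(δ∕n)‖y−t‖∞}∕‖y−t‖∞²` (`y ≠ t`) and `|G y y| ≤ A_d`:
  `Σ_{t ∈ B (n−1) β} |G y t| ≤ (A_d + 865·A₀)·e^{2δ}·n²·e^{−δ·dist (blk (n−1) y) β}` (far blocks: `n⁴` terms `≤ A₀e^{δ}e^{−δD}∕n²`; near blocks: the diagonal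
  + `A₀·Σ_{‖z‖∞ ≤ 2n} nrm(z)⁻² ≤ A₀(1 + 864n²)` by `PoissonInterior.sum_cube_inv_nrm_pow_le`); column form `sum_B_abs_le_of_profile'` for symmetric `G`.
* §2 [folklore] **`exists_sum_B_abs_Ga_le`** (row) and **`exists_sum_B_abs_Ga_col_le`** (column): `∃ C δ, 0 < δ ∧ 0 ≤ C ∧ ∀ n [NeZero n] y β κ l,
  Σ_{t ∈ B (n−1) β} |Ga n a y t κ l| ≤ C·n²·e^{−δ·dist (blk (n−1) y) β}` modulo `h12`∕`h126`; and the fibre-summed row `exists_sum_B_sum_abs_Ga_le` (`Σ_t Σ_l`, constant `4C`).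
NOT HERE (honest): the d1 twin (first differences of `Ga`, mass `O(n)`), any needle row.
Unit `b2b-balaban-beta-d1-p2` (gen 10), road «BF-x» OWNER; `LEAVES-BFx.md` row (N) «GN-L1-MASS».
-/

namespace Summit.QuantumFields.BalabanUV.Beta.D1BFx.GluonLegBlockMass

open Finset Real
open Literature.MathematicalPhysics.QuantumFieldTheory.Balaban1983to89
open Literature.MathematicalPhysics.QuantumFieldTheory.Balaban1983to89.Beta
open B6QGQLower276 (X e blk B mem_B)
open B6QGQDecay237 (dist_blk_ge card_B)
open Beta.PoissonInterior (nrm one_le_nrm nrm_pos supNorm_le_nrm natAbs_le_supNorm exists_natAbs_eq_supNorm supNorm_eq_zero_iff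
  cube mem_cube_zero_iff sum_cube_inv_nrm_pow_le)
open DyadicShell (Pt supNorm)
open VectorTailsLoc (fam kfam)
open Summit.QuantumFields.BalabanUV.Beta.D1BFx.GhostLeg (cast_pred_add_one)
open Summit.QuantumFields.BalabanUV.Beta.D1BFx.GhostLegFree (natAbs_sub_le_blk supNorm_eq nrm_eq_supNorm)
open Summit.QuantumFields.BalabanUV.Beta.D1BFx.GhostLegBlockMass (dist_eq_supNorm)
open Summit.QuantumFields.BalabanUV.Beta.D1BFx.GluonLeg (Ga Ga_apply Ga_symm)
open Summit.QuantumFields.BalabanUV.Beta.D1BFx.GluonLegTails (Kinf_entry_le_of_prop12)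
open Summit.QuantumFields.BalabanUV.Beta.D1BFx.LocalTadpoleRows (abs_Ga_le_flatEntry)
open Summit.QuantumFields.BalabanUV.Beta.D1BFx.FrozenLegTails (nOf MOf hn1)
open Summit.QuantumFields.BalabanUV.Beta.D1BFx.PointColumnSplit (cG0 cG0_nonneg)
open LongitudinalWindow (ellD0)
open WoodburyCovariant (woodburyDc)

noncomputable section

/-! ## §1 The generic block-mass count from a Coulomb × scale-`n`-exponential profile -/

variable (n : ℕ) [NeZero n]

/-- [folklore] **BLOCK-ROW MASS FROM A PROFILE.**  If `|G y t| ≤ A₀·e^{−(δ∕n)‖y−t‖∞}∕‖y−t‖∞²` for `y ≠ t` and `|G y y| ≤ A_d`, then for every block `β`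
of the side-`n` partition `Σ_{t ∈ B (n−1) β} |G y t| ≤ (A_d + 865·A₀)·e^{2δ}·n²·e^{−δ·dist (blk (n−1) y) β}`. -/
theorem sum_B_abs_le_of_profile {G : Pt → Pt → ℝ} {A₀ Ad δ : ℝ} (hA₀ : 0 ≤ A₀) (hAd : 0 ≤ Ad) (hδ0 : 0 < δ)
    (hprof : ∀ y t : Pt, y ≠ t → |G y t| ≤ A₀ * Real.exp (-(δ / n) * supNorm (y - t)) / (supNorm (y - t) : ℝ) ^ 2)
    (hdiag : ∀ y : Pt, |G y y| ≤ Ad) (y β : Pt) :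
    ∑ t ∈ B (n - 1) β, |G y t| ≤ (Ad + 865 * A₀) * Real.exp (2 * δ) * (n : ℝ) ^ 2 * Real.exp (-(δ * dist (blk (n - 1) y) β)) := by
  have hn : (0 : ℝ) < n := by exact_mod_cast Nat.pos_of_ne_zero (NeZero.ne n)
  have hn1 : (1 : ℝ) ≤ n := by exact_mod_cast NeZero.one_le
  set m : ℕ := n - 1 with hm
  have hmn : ((m : ℝ) + 1) = n := cast_pred_add_one n
  set D : ℝ := dist (blk m y) β with hD
  have hD0 : 0 ≤ D := dist_nonneg
  have hy : y ∈ B m (blk m y) := mem_B.2 rfl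
  have hK0 : 0 ≤ Ad + 865 * A₀ := by positivity
  -- lower bound on the site distance from the block distance
  have hlow : ∀ t ∈ B m β, (n : ℝ) * D - m ≤ (supNorm (y - t) : ℝ) := by
    intro t ht
    have h := dist_blk_ge hy ht
    rw [hmn] at h
    rw [dist_eq_supNorm y t] at h
    exact h
  have hmle : (m : ℝ) ≤ n - 1 := by linarith
  by_cases hfar : 2 ≤ D
  · -- FAR blocks: every term ≤ A₀·e^{δ}·e^{−δD}/n², and there are n⁴ terms
    have hterm : ∀ t ∈ B m β, |G y t| ≤ A₀ * Real.exp δ * Real.exp (-(δ * D)) / (n : ℝ) ^ 2 := by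
      intro t ht
      have hN := hlow t ht
      have hNn : (n : ℝ) + 1 ≤ (supNorm (y - t) : ℝ) := by nlinarith
      have hyt : y ≠ t := by
        intro h
        rw [h, sub_self] at hNn
        have : (supNorm (0 : Pt) : ℝ) = 0 := by
          rw [supNorm_eq]; exact_mod_cast (supNorm_eq_zero_iff.2 rfl)
        linarith
      have h1 := hprof y t hyt
      refine h1.trans ?_
      have hNpos : (0 : ℝ) < (supNorm (y - t) : ℝ) := by linarith
      rw [div_le_div_iff₀ (by positivity) (by positivity)]
      have hexp : Real.exp (-(δ / n) * supNorm (y - t)) ≤ Real.exp δ * Real.exp (-(δ * D)) := by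
        rw [← Real.exp_add]
        apply Real.exp_le_exp.2
        have : δ / n * ((n : ℝ) * D - m) ≤ δ / n * (supNorm (y - t) : ℝ) :=
          mul_le_mul_of_nonneg_left hN (div_nonneg hδ0.le hn.le)
        have e2 : δ / n * ((n : ℝ) * D - m) = δ * D - δ * (m / n) := by field_simp
        have e3 : δ * ((m : ℝ) / n) ≤ δ := by
          have : (m : ℝ) / n ≤ 1 := by rw [div_le_one hn]; linarith
          nlinarith
        nlinarith
      have hpoly : (n : ℝ) ^ 2 ≤ (supNorm (y - t) : ℝ) ^ 2 := by
        have : (n : ℝ) ≤ (supNorm (y - t) : ℝ) := by linarith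
        exact pow_le_pow_left₀ hn.le this 2
      calc A₀ * Real.exp (-(δ / n) * supNorm (y - t)) * (n : ℝ) ^ 2
          ≤ A₀ * (Real.exp δ * Real.exp (-(δ * D))) * (supNorm (y - t) : ℝ) ^ 2 := by
            apply mul_le_mul (mul_le_mul_of_nonneg_left hexp hA₀) hpoly (by positivity) (by positivity)
        _ = A₀ * Real.exp δ * Real.exp (-(δ * D)) * (supNorm (y - t) : ℝ) ^ 2 := by ring
    calc ∑ t ∈ B m β, |G y t|
        ≤ ∑ _t ∈ B m β, A₀ * Real.exp δ * Real.exp (-(δ * D)) / (n : ℝ) ^ 2 := Finset.sum_le_sum hterm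
      _ = ((m : ℝ) + 1) ^ 4 * (A₀ * Real.exp δ * Real.exp (-(δ * D)) / (n : ℝ) ^ 2) := by
          rw [Finset.sum_const, nsmul_eq_mul, card_B]
      _ = A₀ * Real.exp δ * (n : ℝ) ^ 2 * Real.exp (-(δ * D)) := by rw [hmn]; field_simp
      _ ≤ (Ad + 865 * A₀) * Real.exp (2 * δ) * (n : ℝ) ^ 2 * Real.exp (-(δ * D)) := by
          apply mul_le_mul_of_nonneg_right _ (Real.exp_pos _).le
          apply mul_le_mul_of_nonneg_right _ (by positivity)
          have h1 : Real.exp δ ≤ Real.exp (2 * δ) := Real.exp_le_exp.2 (by linarith)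
          have h2 : A₀ ≤ Ad + 865 * A₀ := by linarith
          exact mul_le_mul h2 h1 (Real.exp_pos _).le hK0
  · -- NEAR blocks (D ≤ 1): the diagonal term + A₀ · Σ_{0 < ‖z‖_∞ ≤ 2n} ‖z‖_∞^{-2} ≤ A_d + A₀·(1 + 864·n²)
    push Not at hfar
    have hDi : ∀ i : Fin 4, ((blk m y i - β i).natAbs : ℝ) ≤ 1 := by
      intro i
      have h := dist_le_pi_dist (blk m y) β i
      rw [Int.dist_eq] at h
      have e1 : (((blk m y i - β i).natAbs : ℝ)) = |((blk m y i : ℝ) - (β i : ℝ))| := by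
        rw [Nat.cast_natAbs, Int.cast_abs, Int.cast_sub]
      have h2 : ((blk m y i - β i).natAbs : ℝ) < 2 := by rw [e1]; linarith
      have h3 : (blk m y i - β i).natAbs < 2 := by exact_mod_cast h2
      have h4 : (blk m y i - β i).natAbs ≤ 1 := by omega
      exact_mod_cast h4
    have hcube : ∀ t ∈ B m β, y - t ∈ cube (0 : Pt) (2 * n) := by
      intro t ht
      rw [mem_cube_zero_iff, Beta.PoissonInterior.supNorm, Finset.sup_le_iff]
      intro i _
      have h := natAbs_sub_le_blk m y t i
      rw [mem_B.1 ht, hmn] at h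
      have h2 := hDi i
      have h3 : (((y - t) i).natAbs : ℝ) ≤ (n : ℝ) * 1 + m := by nlinarith
      have h4 : (((y - t) i).natAbs : ℝ) ≤ 2 * n := by linarith
      exact_mod_cast h4
    have hsplit : ∑ t ∈ B m β, |G y t| ≤ Ad + ∑ t ∈ (B m β).erase y, |G y t| := by
      by_cases hyB : y ∈ B m β
      · rw [← Finset.add_sum_erase _ _ hyB]
        linarith [hdiag y]
      · rw [Finset.erase_eq_self.2 hyB]
        linarith [Finset.sum_nonneg (fun t (_ : t ∈ B m β) => abs_nonneg (G y t))]
    have hoff : ∀ t ∈ (B m β).erase y, |G y t| ≤ A₀ * (1 / nrm (y - t) ^ 2) := by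
      intro t ht
      rw [Finset.mem_erase] at ht
      have hyt : y ≠ t := fun h => ht.1 h.symm
      have h1 := hprof y t hyt
      refine h1.trans ?_
      have hv : y - t ≠ 0 := sub_ne_zero.2 hyt
      have hnrm : nrm (y - t) = (supNorm (y - t) : ℝ) := nrm_eq_supNorm hv
      have hNpos : (0 : ℝ) < (supNorm (y - t) : ℝ) := by
        have : 0 < DyadicShell.supNorm (y - t) := DyadicShell.supNorm_pos hv
        exact_mod_cast this
      have hexp : Real.exp (-(δ / n) * supNorm (y - t)) ≤ 1 := by
        rw [Real.exp_le_one_iff]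
        have : 0 ≤ δ / n * (supNorm (y - t) : ℝ) := by positivity
        linarith
      rw [hnrm]
      rw [div_le_iff₀ (by positivity)]
      calc A₀ * Real.exp (-(δ / n) * supNorm (y - t)) ≤ A₀ * 1 := mul_le_mul_of_nonneg_left hexp hA₀
        _ = A₀ * (1 / (supNorm (y - t) : ℝ) ^ 2) * (supNorm (y - t) : ℝ) ^ 2 := by field_simp
    have hsumcube : ∑ t ∈ (B m β).erase y, (1 / nrm (y - t) ^ 2) ≤ ∑ z ∈ cube (0 : Pt) (2 * n), 1 / nrm z ^ 2 := by
      rw [← Finset.sum_image (f := fun z : Pt => 1 / nrm z ^ 2) (s := (B m β).erase y) (g := fun t => y - t)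
        (fun t₁ _ t₂ _ h => by simpa using h)]
      apply Finset.sum_le_sum_of_subset_of_nonneg
      · intro z hz
        rw [Finset.mem_image] at hz
        obtain ⟨t, ht, rfl⟩ := hz
        exact hcube t (Finset.mem_of_mem_erase ht)
      · intro z _ _
        have := nrm_pos z
        positivity
    have hcubeval : ∑ z ∈ cube (0 : Pt) (2 * n), 1 / nrm z ^ 2 ≤ 1 + 864 * (n : ℝ) ^ 2 := by
      have h := sum_cube_inv_nrm_pow_le (d := 4) (by norm_num) (2 * n) 2 (by norm_num)
      refine h.trans (le_of_eq ?_)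
      push_cast
      norm_num
      ring
    have hoffsum : ∑ t ∈ (B m β).erase y, |G y t| ≤ A₀ * (1 + 864 * (n : ℝ) ^ 2) := by
      calc ∑ t ∈ (B m β).erase y, |G y t|
          ≤ ∑ t ∈ (B m β).erase y, A₀ * (1 / nrm (y - t) ^ 2) := Finset.sum_le_sum hoff
        _ = A₀ * ∑ t ∈ (B m β).erase y, (1 / nrm (y - t) ^ 2) := by rw [Finset.mul_sum]
        _ ≤ A₀ * (1 + 864 * (n : ℝ) ^ 2) := mul_le_mul_of_nonneg_left (hsumcube.trans hcubeval) hA₀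
    have hn2 : (1 : ℝ) ≤ (n : ℝ) ^ 2 := one_le_pow₀ hn1
    have htot : ∑ t ∈ B m β, |G y t| ≤ (Ad + 865 * A₀) * (n : ℝ) ^ 2 := by
      have h1 : Ad ≤ Ad * (n : ℝ) ^ 2 := le_mul_of_one_le_right hAd hn2
      have h2 : A₀ * (1 + 864 * (n : ℝ) ^ 2) ≤ 865 * A₀ * (n : ℝ) ^ 2 := by nlinarith
      linarith
    refine htot.trans ?_
    have hexp1 : 1 ≤ Real.exp (2 * δ) * Real.exp (-(δ * D)) := by
      rw [← Real.exp_add, Real.one_le_exp_iff]; nlinarith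
    have hpos : 0 ≤ (Ad + 865 * A₀) * (n : ℝ) ^ 2 := by positivity
    calc (Ad + 865 * A₀) * (n : ℝ) ^ 2 = (Ad + 865 * A₀) * (n : ℝ) ^ 2 * 1 := (mul_one _).symm
      _ ≤ (Ad + 865 * A₀) * (n : ℝ) ^ 2 * (Real.exp (2 * δ) * Real.exp (-(δ * D))) := mul_le_mul_of_nonneg_left hexp1 hpos
      _ = (Ad + 865 * A₀) * Real.exp (2 * δ) * (n : ℝ) ^ 2 * Real.exp (-(δ * D)) := by ring

/-- [folklore] **BLOCK-COLUMN MASS FROM A PROFILE** (the same count read on the first argument, for a SYMMETRIC `G`). -/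
theorem sum_B_abs_le_of_profile' {G : Pt → Pt → ℝ} {A₀ Ad δ : ℝ} (hA₀ : 0 ≤ A₀) (hAd : 0 ≤ Ad) (hδ0 : 0 < δ)
    (hsymm : ∀ y t : Pt, G t y = G y t)
    (hprof : ∀ y t : Pt, y ≠ t → |G y t| ≤ A₀ * Real.exp (-(δ / n) * supNorm (y - t)) / (supNorm (y - t) : ℝ) ^ 2)
    (hdiag : ∀ y : Pt, |G y y| ≤ Ad) (y β : Pt) :
    ∑ t ∈ B (n - 1) β, |G t y| ≤ (Ad + 865 * A₀) * Real.exp (2 * δ) * (n : ℝ) ^ 2 * Real.exp (-(δ * dist (blk (n - 1) y) β)) := by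
  simp_rw [hsymm y]
  exact sum_B_abs_le_of_profile n hA₀ hAd hδ0 hprof hdiag y β

/-! ## §2 The gluon leg `Ga`, modulo the two printed statements by name -/

variable {n} (a : ℝ) (ha : 0 < a)

/-- [folklore] `‖t − y‖∞ = ‖y − t‖∞` in the cast currency. -/
theorem supNorm_sub_comm (y t : Pt) : (supNorm (t - y) : ℝ) = (supNorm (y - t) : ℝ) := by
  rw [show t - y = -(y - t) by abel, supNorm_eq, supNorm_eq]
  exact_mod_cast Beta.PoissonInterior.supNorm_neg (y - t)

/-- [folklore] **(L1)-MASS, ROW FORM: THE BLOCK-ROW |·|-MASS OF THE GLUON LEG IS `O(n²)` WITH BLOCK DECAY**, modulo [B5, Prop. 1.2] ∧ [B5, (1.126)–(1.127)]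
BY NAME: one `C ≥ 0`, `δ > 0` with `Σ_{t ∈ B (n−1) β} |Ga n a y t κ l| ≤ C·n²·e^{−δ·dist (blk (n−1) y) β}` for every `n ≥ 1`, `y`, `β`, `κ`, `l`. -/
theorem exists_sum_B_abs_Ga_le (h12 : B5.Prop12Printed (fam nOf hn1 MOf a ha)) (h126 : B5.Kernel126_127Printed (kfam nOf MOf)) :
    ∃ C δ : ℝ, 0 < δ ∧ 0 ≤ C ∧ ∀ (n : ℕ) [NeZero n] (y β : Pt) (κ l : Fin 4),
      ∑ t ∈ B (n - 1) β, |Ga n a y t κ l| ≤ C * (n : ℝ) ^ 2 * Real.exp (-(δ * dist (blk (n - 1) y) β)) := by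
  obtain ⟨δ, A₀, hδ, hA₀, hprof⟩ := Kinf_entry_le_of_prop12 a ha h12 h126
  set Ad : ℝ := cG0 4 + (woodburyDc 0 + ellD0 4 a) + ellD0 4 a with hAd_def
  have hAd : 0 ≤ Ad := by
    have h := abs_Ga_le_flatEntry 1 ha 0 0 0 0
    exact (abs_nonneg _).trans h
  refine ⟨(Ad + 865 * A₀) * Real.exp (2 * δ), δ, hδ, by positivity, fun n _ y β κ l => ?_⟩
  have h := sum_B_abs_le_of_profile n (G := fun y t => Ga n a y t κ l) hA₀ hAd hδ
    (fun y t hyt => by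
      have hw : t - y ≠ 0 := sub_ne_zero.2 (Ne.symm hyt)
      have h1 := hprof n y (t - y) κ l hw
      rw [add_sub_cancel] at h1
      simpa only [Ga_apply, supNorm_sub_comm] using h1)
    (fun y => abs_Ga_le_flatEntry n ha y y κ l) y β
  simpa only [mul_assoc] using h

/-- [folklore] **(L1)-MASS, COLUMN FORM** (by the symmetry `Ga n a y t κ l = Ga n a t y l κ`): `Σ_{t ∈ B (n−1) β} |Ga n a t y κ l| ≤ C·n²·e^{−δ·dist (blk (n−1) y) β}`. -/
theorem exists_sum_B_abs_Ga_col_le (h12 : B5.Prop12Printed (fam nOf hn1 MOf a ha)) (h126 : B5.Kernel126_127Printed (kfam nOf MOf)) :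
    ∃ C δ : ℝ, 0 < δ ∧ 0 ≤ C ∧ ∀ (n : ℕ) [NeZero n] (y β : Pt) (κ l : Fin 4),
      ∑ t ∈ B (n - 1) β, |Ga n a t y κ l| ≤ C * (n : ℝ) ^ 2 * Real.exp (-(δ * dist (blk (n - 1) y) β)) := by
  obtain ⟨C, δ, hδ, hC, h⟩ := exists_sum_B_abs_Ga_le a ha h12 h126
  refine ⟨C, δ, hδ, hC, fun n _ y β κ l => ?_⟩
  have hs : ∀ t, Ga n a t y κ l = Ga n a y t l κ := fun t => Ga_symm n a NeZero.one_le ha t y κ l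
  simp_rw [hs]
  exact h n y β l κ

/-- [folklore] **(L1)-MASS, FIBRE-SUMMED ROW FORM**: `Σ_{t ∈ B (n−1) β} Σ_l |Ga n a y t κ l| ≤ 4C·n²·e^{−δ·dist (blk (n−1) y) β}`. -/
theorem exists_sum_B_sum_abs_Ga_le (h12 : B5.Prop12Printed (fam nOf hn1 MOf a ha)) (h126 : B5.Kernel126_127Printed (kfam nOf MOf)) :
    ∃ C δ : ℝ, 0 < δ ∧ 0 ≤ C ∧ ∀ (n : ℕ) [NeZero n] (y β : Pt) (κ : Fin 4),
      ∑ t ∈ B (n - 1) β, ∑ l : Fin 4, |Ga n a y t κ l| ≤ C * (n : ℝ) ^ 2 * Real.exp (-(δ * dist (blk (n - 1) y) β)) := by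
  obtain ⟨C, δ, hδ, hC, h⟩ := exists_sum_B_abs_Ga_le a ha h12 h126
  refine ⟨4 * C, δ, hδ, by positivity, fun n _ y β κ => ?_⟩
  rw [Finset.sum_comm]
  calc ∑ l : Fin 4, ∑ t ∈ B (n - 1) β, |Ga n a y t κ l|
      ≤ ∑ _l : Fin 4, C * (n : ℝ) ^ 2 * Real.exp (-(δ * dist (blk (n - 1) y) β)) := Finset.sum_le_sum fun l _ => h n y β κ l
    _ = 4 * C * (n : ℝ) ^ 2 * Real.exp (-(δ * dist (blk (n - 1) y) β)) := by
        rw [Finset.sum_const, Finset.card_univ, Fintype.card_fin, nsmul_eq_mul]; push_cast; ring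

end

end Summit.QuantumFields.BalabanUV.Beta.D1BFx.GluonLegBlockMass
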